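import Mathlib

/-!
# Conjecture N (hodge-weil ladder, GAPS G51b), format (5,3): CROSS + ONE FREE ROOT — the endpoint principle

Prover 2, generation 22 (note `run/shared/lean/b2b/hodge-weil/b2b-hweil-pv2-g22/CROSSPLUS1-G22.md`). First file of the 'cross + one free
E-root' theorem (Conjecture N WITH the purity relation P1 on the boundary stratum next to the crosses of generation 21's cross lemma,
`WeilClassTestFormatFiveThreeCrossLemma`). In the reduced system of that note, for fixed first moments the two second moments `(D1, E1)`
range over the line `{K = 0}` (purity P1), on which `G = Q₂ + Q₄` and the two Cauchy–Schwarz defects `h_p`, `h_m` are CONCAVE quadratics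
(leading coefficients `−4M/X`, `−1`, `−(M/X)²`). This file isolates the elementary real-analysis step used there:

* `endpoint_right`, **`endpoint_principle`** — if `g(s) = a s² + b s + c` with `a ≤ 0`, `p(s) = −s² + β s + γ` and `q` is continuous, and
  `g ≥ 0` holds at every zero of `p` in `{q ≥ 0}` and at every zero of `q` in `{p ≥ 0}`, then `g ≥ 0` on the whole compact set
  `{p ≥ 0} ∩ {q ≥ 0}` (move from a feasible point in the direction in which `g` does not increase, to the last feasible point — a supremum,
  attained by closedness — where `p` or `q` vanishes by continuity).

Pure real analysis (Mathlib: `IsClosed.csSup_mem`, `Metric.eventually_nhds_iff`); nothing here is a case of HC, a rung or a door edge.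
New cell result ⇒ Summits/.
-/

set_option linter.dupNamespace false

namespace Summit.HodgeConjecture.HodgeConjecture.WeilClassTestFormatFiveThreeCrossPlusOneEndpoint

/-- ENDPOINT PRINCIPLE, one-sided form. `g(s) = a s² + b s + c` with `a ≤ 0`, `p(s) = −s² + β s + γ`, `q` continuous; if `g ≥ 0` at every
zero of `p` where `q ≥ 0` and at every zero of `q` where `p ≥ 0`, then `g ≥ 0` at every point `s₀` with `p(s₀), q(s₀) ≥ 0` at which `g` is
non-increasing (`2a s₀ + b ≤ 0`): move right to the last feasible point, which is a zero of `p` or of `q`. -/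
theorem endpoint_right (g p q : ℝ → ℝ) (a b c β γ : ℝ) (ha : a ≤ 0)
    (hg : ∀ s, g s = a * s ^ 2 + b * s + c) (hp : ∀ s, p s = -s ^ 2 + β * s + γ) (hq : Continuous q)
    (hP : ∀ s, p s = 0 → 0 ≤ q s → 0 ≤ g s) (hQ : ∀ s, q s = 0 → 0 ≤ p s → 0 ≤ g s)
    (s₀ : ℝ) (hp₀ : 0 ≤ p s₀) (hq₀ : 0 ≤ q s₀) (hdir : 2 * a * s₀ + b ≤ 0) : 0 ≤ g s₀ := by
  set F : Set ℝ := {s | s₀ ≤ s ∧ 0 ≤ p s ∧ 0 ≤ q s} with hF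
  have hpc : Continuous p := by
    have : p = fun s => -s ^ 2 + β * s + γ := funext hp
    rw [this]; fun_prop
  have hFne : F.Nonempty := ⟨s₀, le_rfl, hp₀, hq₀⟩
  have hFbdd : BddAbove F := by
    refine ⟨|β| + |γ| + 1, ?_⟩
    intro s hs
    by_contra hlt
    push Not at hlt
    have hps := hs.2.1
    rw [hp] at hps
    have h1 : 1 < s := by linarith [abs_nonneg β, abs_nonneg γ]
    have hb : β * s ≤ |β| * s := mul_le_mul_of_nonneg_right (le_abs_self β) (by linarith)
    have hc : γ ≤ |γ| * s := by nlinarith [le_abs_self γ, abs_nonneg γ]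
    nlinarith
  have hFclosed : IsClosed F := by
    have : F = (Set.Ici s₀ ∩ (p ⁻¹' Set.Ici 0)) ∩ (q ⁻¹' Set.Ici 0) := by
      ext s; simp [hF, and_assoc]
    rw [this]
    exact (isClosed_Ici.inter (isClosed_Ici.preimage hpc)).inter (isClosed_Ici.preimage hq)
  have hs₁F : sSup F ∈ F := hFclosed.csSup_mem hFne hFbdd
  obtain ⟨h01, hp1, hq1⟩ := hs₁F
  have hzero : p (sSup F) = 0 ∨ q (sSup F) = 0 := by
    by_contra hne
    push Not at hne
    have hp1' : 0 < p (sSup F) := lt_of_le_of_ne hp1 (Ne.symm hne.1)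
    have hq1' : 0 < q (sSup F) := lt_of_le_of_ne hq1 (Ne.symm hne.2)
    have ev : ∀ᶠ s in nhds (sSup F), 0 < p s ∧ 0 < q s :=
      (hpc.continuousAt.eventually (lt_mem_nhds hp1')).and (hq.continuousAt.eventually (lt_mem_nhds hq1'))
    obtain ⟨δ, hδ, hball⟩ := Metric.eventually_nhds_iff.mp ev
    have hmem : sSup F + δ / 2 ∈ F := by
      have hd : dist (sSup F + δ / 2) (sSup F) < δ := by
        rw [Real.dist_eq]
        rw [show sSup F + δ / 2 - sSup F = δ / 2 by ring, abs_of_pos (by linarith)]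
        linarith
      obtain ⟨hp2, hq2⟩ := hball hd
      exact ⟨by linarith, hp2.le, hq2.le⟩
    have := le_csSup hFbdd hmem
    linarith
  have hg1 : 0 ≤ g (sSup F) := by
    rcases hzero with h | h
    · exact hP _ h hq1
    · exact hQ _ h hp1
  rw [hg] at hg1 ⊢
  have hdiff : a * s₀ ^ 2 + b * s₀ + c - (a * sSup F ^ 2 + b * sSup F + c) = (s₀ - sSup F) * (a * (s₀ + sSup F) + b) := by ring
  have h2 : a * (s₀ + sSup F) + b ≤ 0 := by nlinarith
  nlinarith [mul_nonneg_of_nonpos_of_nonpos (by linarith : s₀ - sSup F ≤ 0) h2]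

/-- ENDPOINT PRINCIPLE. `g(s) = a s² + b s + c` concave (`a ≤ 0`), `p(s) = −s² + β s + γ`, `q` continuous. If `g ≥ 0` at the zeros of `p` inside
`{q ≥ 0}` and at the zeros of `q` inside `{p ≥ 0}`, then `g ≥ 0` on all of `{p ≥ 0} ∩ {q ≥ 0}` (a compact set on whose boundary `p·q = 0`;
a concave function on an interval is minimised at an end point). -/
theorem endpoint_principle (g p q : ℝ → ℝ) (a b c β γ : ℝ) (ha : a ≤ 0)
    (hg : ∀ s, g s = a * s ^ 2 + b * s + c) (hp : ∀ s, p s = -s ^ 2 + β * s + γ) (hq : Continuous q)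
    (hP : ∀ s, p s = 0 → 0 ≤ q s → 0 ≤ g s) (hQ : ∀ s, q s = 0 → 0 ≤ p s → 0 ≤ g s)
    (s₀ : ℝ) (hp₀ : 0 ≤ p s₀) (hq₀ : 0 ≤ q s₀) : 0 ≤ g s₀ := by
  rcases le_or_gt (2 * a * s₀ + b) 0 with h | h
  · exact endpoint_right g p q a b c β γ ha hg hp hq hP hQ s₀ hp₀ hq₀ h
  · have key := endpoint_right (fun s => g (-s)) (fun s => p (-s)) (fun s => q (-s)) a (-b) c (-β) γ ha
      (fun s => by rw [hg]; ring) (fun s => by rw [hp]; ring) (hq.comp continuous_neg)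
      (fun s h1 h2 => hP (-s) h1 h2) (fun s h1 h2 => hQ (-s) h1 h2) (-s₀) (by simpa using hp₀) (by simpa using hq₀) (by linarith)
    simpa using key

end Summit.HodgeConjecture.HodgeConjecture.WeilClassTestFormatFiveThreeCrossPlusOneEndpoint
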